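import Summits.NavierStokesRegularity.FunctionalMining.NoGo.StretchingStrainL4Floor
import Literature.Analysis.FunctionSpaces.TorusSecondRieszSharp
import HarnessLib

/-!
# Functional mining (K1-Q1 door D2a, bridge): the floor `K⋆₄ ≥ 81/4` of the `L⁴` Calderón–Zygmund door, conditional on the NAMED Literature fact of Geiss–Montgomery-Smith–Saksman

Search for candidate a priori estimates; no regularity claim.

Cell `pub-nsfunc`, dict seat (gen 11), STAGED for the prove seat (target tree path
`Summits/NavierStokesRegularity/FunctionalMining/NoGo/StretchingStrainL4FloorGMS.lean`; file AFTER
`NoGo/StretchingStrainL4FloorField.lean` and `NoGo/StretchingStrainL4Floor.lean`). Typed question K1-Q1,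
door D2a FLOOR (`HOME/DICTIONARY.md` §14; `HOME/pub-nsfunc-dict/K1Q1-LADDER.md` §B; no-go seat THEOREM K4,
`HOME/pub-nsfunc-nogo/KSTAR4.md`).

CONTEXT. `NoGo/StretchingStrainL4Floor.lean` proves UNCONDITIONALLY `StrainL4Bound (d := Fin 3) K → 1/4 ≤ K`
and, under the displayed hypothesis `StrainL4Floor.SecondRieszQuarticLower 3` (for every `c < 81` a smooth
`ψ` on `𝕋²` with `0 < ∫(Δψ)⁴` and `c∫(Δψ)⁴ ≤ ∫(□ψ)⁴`), `StrainL4Bound K → 81/4 ≤ K` and the floor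
`2/√3 − 1/(328√3)` of the door's constants. The literature seat has since typed the published sharp lower
bound `‖R₁² − R₂²‖_{L^p} ≥ p* − 1` as the NAMED FACT
`Literature.Analysis.FunctionSpaces.Torus.secondRiesz_box_laplacian_lower_sharp` — a `def … : Prop` with
citation tags (Geiss–Montgomery-Smith–Saksman, Trans. AMS 362 (2010), Cor. 1.1 and Lemma 2.2), NOTHING
ASSERTED and no kernel proof — together with the PROVED fourth-power specialisation
`secondRiesz_box_laplacian_lower_sharp.quartic`, which is literally `SecondRieszQuarticLower 3` once
`StrainL4Floor.lap` / `StrainL4Floor.box` are unfolded.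

THEOREMS (this file is only the bridge; every conclusion is CONDITIONAL on the named fact, displayed as
the hypothesis `h`):
* `secondRieszQuarticLower_three : secondRiesz_box_laplacian_lower_sharp → SecondRieszQuarticLower 3`;
* `strainL4Bound_ge_of_sharpLower : … → StrainL4Bound K → 81/4 ≤ K` (kernel form of THEOREM K4 modulo
  the cited `Prop`);
* `not_strainL4Bound_of_lt_of_sharpLower : … → K < 81/4 → ¬ StrainL4Bound K`;
* `door_const_ge_of_sharpLower : … → StrainL4Bound K → 2/√3 − 1/(328√3) ≤ 2/√3 − 1/(4√3(4K+1))`.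

HONEST SIZE. A statement about the REACH OF ONE METHOD (the `L⁴` door can certify nothing below
`≈ 1.1529403`), not a bound on `C⋆` and not a statement about Navier–Stokes solutions; the unconditional
kernel part (`1/4 ≤ K`, floor `≈ 1.08253`) is in `NoGo/StretchingStrainL4Floor.lean`.
-/

noncomputable section

open MeasureTheory Set

namespace Summit.NavierStokesRegularity.FunctionalMining

open Literature.Analysis.FunctionSpaces Literature.Analysis.FunctionSpaces.Torus

namespace StrainL4Floor

/-- **The bridge**: the named Literature fact (`‖R₁² − R₂²‖_{L^p(𝕋²), mean zero} ≥ p* − 1`, here at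
`p = 4`) gives `SecondRieszQuarticLower 3` — by `secondRiesz_box_laplacian_lower_sharp.quartic`, whose
statement is the body of `SecondRieszQuarticLower 3` with `lap`/`box` unfolded. Search for candidate a
priori estimates; no regularity claim. [ours — K1-Q1 door D2a; the input is the cited `Prop`, displayed as `h`] -/
theorem secondRieszQuarticLower_three (h : secondRiesz_box_laplacian_lower_sharp) :
    SecondRieszQuarticLower 3 :=
  fun c hc => h.quartic c hc

/-- **`K⋆₄ ≥ 81/4` modulo the named fact**: every admissible `K` in `StrainL4Bound (d := Fin 3) K`
satisfies `81/4 ≤ K`. Search for candidate a priori estimates; no regularity claim. [ours] -/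
theorem strainL4Bound_ge_of_sharpLower (h : secondRiesz_box_laplacian_lower_sharp) {K : ℝ}
    (hK : StrainL4Bound (d := Fin 3) K) : (81 : ℝ) / 4 ≤ K :=
  strainL4Bound_ge_of_three (secondRieszQuarticLower_three h) hK

/-- No `K < 81/4` is admissible, modulo the named fact. Search for candidate a priori estimates; no
regularity claim. [ours] -/
theorem not_strainL4Bound_of_lt_of_sharpLower (h : secondRiesz_box_laplacian_lower_sharp) {K : ℝ}
    (hK : K < 81 / 4) : ¬ StrainL4Bound (d := Fin 3) K :=
  not_strainL4Bound_of_lt (secondRieszQuarticLower_three h) hK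

/-- **The door's floor modulo the named fact**: the constant `2/√3 − 1/(4√3(4K+1))` delivered by
`stretchingSupBound_of_strainL4Bound` is at least `2/√3 − 1/(328√3) ≈ 1.1529403` for every admissible `K`.
Search for candidate a priori estimates; no regularity claim. [ours] -/
theorem door_const_ge_of_sharpLower (h : secondRiesz_box_laplacian_lower_sharp) {K : ℝ}
    (hK : StrainL4Bound (d := Fin 3) K) :
    2 / Real.sqrt 3 - 1 / (328 * Real.sqrt 3) ≤ 2 / Real.sqrt 3 - 1 / (4 * Real.sqrt 3 * (4 * K + 1)) :=
  door_const_ge (secondRieszQuarticLower_three h) hK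

end StrainL4Floor

end Summit.NavierStokesRegularity.FunctionalMining

end
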